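import Mathlib
import Summits.ValiantsHypothesis.ValiantsHypothesis.Theorems.FifoMatchingNNDivisionHardBlockNewtonDimension
import HarnessLib

/-!
# Route FifoMatching — crux `NNDivisionHard` (stmt-ValiantsHypothesis-21181): CERTIFICATES ARE DENSE IN VARIABLES AT EVERY
# SCALE — `≥ n/(log₂ n)^k` distinct arc variables, and `≥ b/(log₂ n)^k` inside every aligned block of half-size `b`

The Newton dimension of a polynomial (resp. of its block-restricted exponents) is at most the number of arc variables it uses
(resp. uses inside the block): all exponent vectors lie in the coordinate subspace of the occurring variables.  With the
dimension tiers `…PolylogArcFaces.polylogNewtonDim_not_certificate_qp'` and `…BlockNewtonDimension.blockNewtonDim_not_certificate_qp'`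
(this hand) this gives a quantitative form of the tree's window/block-density tiers (`…BlockAvoidance`: at least ONE variable
internal to every large aligned block):

* `finrank_vectorSpan_le_card_vars`, `finrank_vectorSpan_block_le_card` — dimension ≤ number of (block) variables used;
* ★★ `fewVars_not_certificate_qp` — **for every `c` there are `k, n₀`: for `n ≥ n₀`, every `h ≠ 0` with
  `(|vars h| + 1)(log₂ n)^k ≤ n` is not a certificate** (`2^((log₂ n + c)^c) < L₊(NN_n · h) + L₊(h)`);
* ★★ `fewBlockVars_not_certificate_qp` — **for every `c` there are `k, n₀`: for `n = i + (b + c') ≥ n₀`, every `h ≠ 0` using at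
  most `V` arc variables internal to the aligned block `[2i, 2i+2b)` with `(V + 1)(log₂ n)^k ≤ b` is not a certificate** —
  certificates use `≥ b/(log₂ n)^k` variables inside EVERY aligned block of half-size `b ≥ (log₂ n)^k`.

HONEST FRAMING: corollaries of the dimension rungs toward ONE crux; stmt-21181 stays OPEN; nothing here bears on `NNNotVP` or on
VP ≠ VNP (NOT proved).  No definitions, no named facts.
References: Hrubeš–Yehudayoff 2021 §6 Problem 2 [HrubesYehudayoff2021]; Bürgisser 2000 Rem. 2.7 [Burgisser2000].
-/

noncomputable section

-- Sub = Summit single-conjunct layout: the duplicated namespace component is mandated by the tree.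
set_option linter.dupNamespace false
set_option autoImplicit false

namespace Summit.ValiantsHypothesis.ValiantsHypothesis.Theorems.FifoMatching.NNDivisionHard.ManyVariables

open Finset MvPolynomial Literature.Computability.AlgebraicComplexity
open Summit.ValiantsHypothesis.ValiantsHypothesis.Theorems.FifoMatching.NNDivisionHard.StackPowersQueue
  (blockEmb blockEmb_injective)
open Summit.ValiantsHypothesis.ValiantsHypothesis.Theorems.FifoMatching.NNDivisionHard.SplitFace
  (blockEmbR two_mul_le blockEmbR_injective)
open Summit.ValiantsHypothesis.ValiantsHypothesis.Theorems.FifoMatching.NNDivisionHard.PolylogArcFaces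
  (polylogNewtonDim_not_certificate_qp')
open Summit.ValiantsHypothesis.ValiantsHypothesis.Theorems.FifoMatching.NNDivisionHard.BlockNewtonDimension
  (blockNewtonDim_not_certificate_qp')
open scoped NNReal BigOperators

/-! ### §1 Dimension ≤ number of occurring variables -/

section Dim

variable {σ τ : Type*} [Fintype τ] [DecidableEq τ]

/-- Points with coordinates supported in `K` span (affinely) a space of dimension `≤ |K|`. [folklore] -/
theorem finrank_vectorSpan_le_card_of_coords {P : Set (τ → ℚ)} (K : Finset τ)
    (hP : ∀ p ∈ P, ∀ t, p t ≠ 0 → t ∈ K) :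
    Module.finrank ℚ (vectorSpan ℚ P) ≤ K.card := by
  classical
  have hle : vectorSpan ℚ P ≤ Submodule.span ℚ ((K.image fun t => (Pi.single t (1 : ℚ) : τ → ℚ)) : Set (τ → ℚ)) := by
    rw [vectorSpan_def]
    refine Submodule.span_le.2 ?_
    intro v hv
    obtain ⟨p, hp, q, hq, rfl⟩ := Set.mem_vsub.1 hv
    have hrepr : p -ᵥ q = ∑ t ∈ K, (p t - q t) • (Pi.single t (1 : ℚ) : τ → ℚ) := by
      funext x
      simp only [vsub_eq_sub, Pi.sub_apply, Finset.sum_apply, Pi.smul_apply, Pi.single_apply, smul_eq_mul,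
        mul_ite, mul_one, mul_zero]
      rw [Finset.sum_ite_eq]
      split_ifs with hx
      · rfl
      · have hpx : p x = 0 := by by_contra hne; exact hx (hP p hp x hne)
        have hqx : q x = 0 := by by_contra hne; exact hx (hP q hq x hne)
        rw [hpx, hqx, sub_zero]
    rw [SetLike.mem_coe, hrepr]
    exact Submodule.sum_mem _ fun t ht => Submodule.smul_mem _ _
      (Submodule.subset_span (Finset.mem_coe.2 (Finset.mem_image_of_mem _ ht)))
  exact (Submodule.finrank_mono hle).trans ((finrank_span_finset_le_card _).trans Finset.card_image_le)

/-- `dim Newt(h) ≤ |vars h|`. [folklore] -/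
theorem finrank_vectorSpan_le_card_vars [Fintype σ] [DecidableEq σ] (h : MvPolynomial σ ℝ≥0) :
    Module.finrank ℚ (vectorSpan ℚ ((fun u : σ →₀ ℕ => fun a : σ => (u a : ℚ)) '' (h.support : Set (σ →₀ ℕ)))) ≤
      h.vars.card := by
  refine finrank_vectorSpan_le_card_of_coords h.vars ?_
  rintro p ⟨u, hu, rfl⟩ a ha
  have hua : u a ≠ 0 := fun h0 => ha (by simp [h0])
  exact (mem_vars_iff_mem_support a).2 ⟨u, Finset.mem_coe.1 hu, Finsupp.mem_support_iff.2 hua⟩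

/-- The block-restricted Newton dimension is at most the number of block arc variables occurring in `h`. [folklore] -/
theorem finrank_vectorSpan_block_le_card [DecidableEq σ] (ι : τ → σ) (h : MvPolynomial σ ℝ≥0) :
    Module.finrank ℚ (vectorSpan ℚ ((fun u : σ →₀ ℕ => fun t : τ => (u (ι t) : ℚ)) '' (h.support : Set (σ →₀ ℕ)))) ≤
      ((Finset.univ : Finset τ).filter fun t => ι t ∈ h.vars).card := by
  refine finrank_vectorSpan_le_card_of_coords _ ?_
  rintro p ⟨u, hu, rfl⟩ t ht
  have hut : u (ι t) ≠ 0 := fun h0 => ht (by simp [h0])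
  exact Finset.mem_filter.2 ⟨Finset.mem_univ _,
    (mem_vars_iff_mem_support _).2 ⟨u, Finset.mem_coe.1 hu, Finsupp.mem_support_iff.2 hut⟩⟩

end Dim

/-! ### §2 Certificates are dense in variables -/

/-- ★★ **FEW VARIABLES ⇒ NOT A CERTIFICATE**: for every `c` there are `k, n₀` with: for all `n ≥ n₀`, every `h ≠ 0` with
`(|vars h| + 1)(log₂ n)^k ≤ n` satisfies `2^((log₂ n + c)^c) < L₊(NN_n · h) + L₊(h)`. [cite: HrubesYehudayoff2021, §6 Problem 2] -/
theorem fewVars_not_certificate_qp (c : ℕ) : ∃ k n₀ : ℕ, ∀ n : ℕ, n₀ ≤ n →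
    ∀ h : MvPolynomial (Fin (2 * n) × Fin (2 * n)) ℝ≥0, h ≠ 0 → (h.vars.card + 1) * (Nat.log 2 n) ^ k ≤ n →
      2 ^ ((Nat.log 2 n + c) ^ c) < complexity (nestFreeMatchingPoly n ℝ≥0 * h) + complexity h := by
  classical
  obtain ⟨k, n₀, hk⟩ := polylogNewtonDim_not_certificate_qp' c
  refine ⟨k, n₀, fun n hn h hh hV => hk n hn h hh (le_trans (Nat.mul_le_mul_right _ ?_) hV)⟩
  exact Nat.add_le_add_right (finrank_vectorSpan_le_card_vars h) 1

/-- ★★ **FEW VARIABLES INSIDE SOME LARGE ALIGNED BLOCK ⇒ NOT A CERTIFICATE**: for every `c` there are `k, n₀` with: for all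
`n = i + (b + c') ≥ n₀`, every `h ≠ 0` using `V` arc variables internal to the aligned block `[2i, 2i+2b)` with
`(V + 1)(log₂ n)^k ≤ b` satisfies `2^((log₂ n + c)^c) < L₊(NN_n · h) + L₊(h)` — certificates use `≥ b/(log₂ n)^k` variables
inside EVERY aligned block of half-size `b`. [cite: HrubesYehudayoff2021, §6 Problem 2] [cite: Burgisser2000, Rem. 2.7] -/
theorem fewBlockVars_not_certificate_qp (c : ℕ) : ∃ k n₀ : ℕ, ∀ i b c' : ℕ, n₀ ≤ i + (b + c') →
    ∀ h : MvPolynomial (Fin (2 * (i + (b + c'))) × Fin (2 * (i + (b + c')))) ℝ≥0, h ≠ 0 →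
      (((Finset.univ : Finset (Fin (2 * b) × Fin (2 * b))).filter fun t =>
          blockEmbR i (b + c') (blockEmb (two_mul_le b c') t) ∈ h.vars).card + 1) *
        (Nat.log 2 (i + (b + c'))) ^ k ≤ b →
      2 ^ ((Nat.log 2 (i + (b + c')) + c) ^ c) <
        complexity (nestFreeMatchingPoly (i + (b + c')) ℝ≥0 * h) + complexity h := by
  classical
  obtain ⟨k, n₀, hk⟩ := blockNewtonDim_not_certificate_qp' c
  refine ⟨k, n₀, fun i b c' hn h hh hV => hk i b c' hn h hh (le_trans (Nat.mul_le_mul_right _ ?_) hV)⟩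
  exact Nat.add_le_add_right
    (finrank_vectorSpan_block_le_card (fun t => blockEmbR i (b + c') (blockEmb (two_mul_le b c') t)) h) 1

end Summit.ValiantsHypothesis.ValiantsHypothesis.Theorems.FifoMatching.NNDivisionHard.ManyVariables

end
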